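import Summits.AtomisticToContinuum.BoseEinsteinCondensation.Theorems.BECSwapNoCatastropheTorusHalfSwapOverlapUpperFrameIntegrable
import Literature.MathematicalPhysics.QuantumManyBody.PeriodicBoseGasJastrow
import HarnessLib

/-!
# Crux `TorusHalfSwapOverlap` (stmt-AtomisticToContinuum-14393), line `birth`, stub `stub_upperFrameHardCore` (S7),
# part B: hard-core support, packing of the active bath particles, the averaging kernel

Route `BECSwapNoCatastrophe` (sub-problem `BoseEinsteinCondensation`), lead c6 (2026-08-17). Second of four files
proving the HARD-CORE UPPER FRAME `inf_{Adm0} E2(½) ≤ 2 E₀^per(n+1, L) + C n L⁻³`. Contents: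

* HARD-CORE SUPPORT (`le_norm_sub_sub_latticeVec`): a periodic trial state `Ψ` of finite energy for a profile with
  `v = ⊤` on `[0, a]` vanishes wherever some pair has a lattice image closer than `a`:
  `Ψ X ≠ 0 ⇒ |xᵢ - xⱼ - Lm| ≥ a` for all `i ≠ j`, `m ∈ ℤ³`. Proof: otherwise `W|Ψ|² = ⊤` on an open set around `X`;
  shifting the cell integral by periodicity (`lintegral_cellN_comp_add`) so that this set meets the open box in
  positive Lebesgue measure makes the potential energy infinite.
* PACKING (`exists_active_finset`): on such a configuration, for every `x ∈ ℝ³` the bath particles `yⱼ₊₁` whose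
  nearest image `reduce L (x - yⱼ₊₁)` lies within `b` form a set of `≤ (1 + 2b/a)³` indices — the reduced vectors
  are pairwise `≥ a` apart (differences of reduced vectors are lattice images of differences), and the volume
  packing bound (hypothesis `hPk`, the landed `stub_hardCorePacking`) applies.
* THE AVERAGING KERNEL: for a periodic pair factor `Φ = pairFactor L φ` the one-body kernel
  `G = c₁ |∇Φ|² + (1 - Φ²)` is measurable, even, `Lℤ³`-periodic, with cell averages
  `∫_{[0,L)³} G(t - z) dt ≤ c₁ ∫_{ℝ³} |∇φ|² + ∫_{ℝ³} (1 - φ²)` (`lintegral_cell_kernel_le`, unfolding the torus); the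
  two-copy cross weight `W(X, Y) = ∑ⱼ (G(x₀ - yⱼ₊₁) + G(y₀ - xⱼ₊₁))` is measurable, periodic in the second copy, with
  shifted cell average `≤ n · 2C` (`lintegral_cell_crossKernel_shift_le`); and the `≤` form of the generic
  translation-averaging identity of part S6b (`lintegral_cell_translate_le`, adapted from
  `UpperFrameIntegrable.lintegral_cell_translate_eq`) together with the measurability in `t` of the translated cross
  integral (`measurable_lintegral_translate`, for the first-moment method).

All folklore.
-/

noncomputable section

open MeasureTheory Filter
open scoped ENNReal NNReal BigOperators ComplexConjugate

namespace Summit.AtomisticToContinuum.BoseEinsteinCondensation.Cruxes.TorusHalfSwapOverlap.Birth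

open Literature.MathematicalPhysics.QuantumManyBody.BoseGas

/-! ### Helper lemmas (inside `namespace UpperFrameHardCoreSupport … end UpperFrameHardCoreSupport`) -/

namespace UpperFrameHardCoreSupport

/-! #### Hard-core support of a finite-energy periodic trial state -/


variable {N : ℕ} {L : ℝ}

/-- The open box `(0, L)^{3N}` is an open subset of the cell `[0, L)^{3N}`. [folklore] -/
theorem isOpen_openBox (N : ℕ) (L : ℝ) : IsOpen {X : Config N | ∀ i k, X i k ∈ Set.Ioo 0 L} := by
  have h : {X : Config N | ∀ i k, X i k ∈ Set.Ioo 0 L} = ⋂ i, ⋂ k, (fun X : Config N => X i k) ⁻¹' Set.Ioo 0 L := by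
    ext X; simp
  rw [h]
  exact isOpen_iInter_of_finite fun i => isOpen_iInter_of_finite fun k => isOpen_Ioo.preimage (by fun_prop)

/-- A hard-core image of a pair makes the periodised potential infinite: if `v = ⊤` on `[0, a]` and
`|xᵢ - xⱼ - Lm| ≤ a` then `v^per(xᵢ - xⱼ) = ⊤`. [folklore] -/
theorem periodizedPotential_eq_top {v : ℝ → ℝ≥0∞} {a : ℝ} (hcore : ∀ r, 0 ≤ r → r ≤ a → v r = ⊤) (L : ℝ)
    {y : Space} {m : Fin 3 → ℤ} (hm : ‖y - latticeVec L m‖ ≤ a) : periodizedPotential v L y = ⊤ :=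
  ENNReal.tsum_eq_top_of_eq_top ⟨m, hcore _ (norm_nonneg _) hm⟩

/-- … and hence the periodic interaction of the configuration is infinite (`i < j`). [folklore] -/
theorem periodicInteraction_eq_top {v : ℝ → ℝ≥0∞} {a : ℝ} (hcore : ∀ r, 0 ≤ r → r ≤ a → v r = ⊤) (L : ℝ)
    {X : Config N} {i j : Fin N} (hij : i < j) {m : Fin 3 → ℤ} (hm : ‖X i - X j - latticeVec L m‖ ≤ a) :
    periodicInteraction v L X = ⊤ := by
  unfold periodicInteraction
  refine ENNReal.sum_eq_top.2 ⟨i, Finset.mem_univ _, ?_⟩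
  exact ENNReal.sum_eq_top.2 ⟨j, Finset.mem_filter.2 ⟨Finset.mem_univ _, hij⟩, periodizedPotential_eq_top hcore L hm⟩

/-- **Hard-core support (ordered pair).** A periodic trial state of finite energy vanishes wherever some pair
`i < j` has a lattice image within the hard core: `|xᵢ - xⱼ - Lm| < a ⇒ Ψ X = 0`. Otherwise `|Ψ|² > 0` and
`W = ⊤` on an open set; shifting the cell integral (periodicity) so that this set meets the open box in positive
measure gives infinite potential energy. [folklore] -/
theorem psi_eq_zero_of_lt {v : ℝ → ℝ≥0∞} {a : ℝ} (hcore : ∀ r, 0 ≤ r → r ≤ a → v r = ⊤) (hL : 0 < L)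
    (Ψ : PeriodicTrialState N L) (hE : periodicEnergy v Ψ ≠ ⊤) {X : Config N} {i j : Fin N} (hij : i < j)
    {m : Fin 3 → ℤ} (hm : ‖X i - X j - latticeVec L m‖ < a) : Ψ.ψ X = 0 := by
  by_contra hX
  -- the shifted integrand `G(· + T)`, `T = X - c`, `c` the centre of the open box
  set c : Config N := fun _ => WithLp.toLp 2 fun _ => L / 2 with hc
  set T : Config N := X - c with hT
  set G : Config N → ℝ≥0∞ := fun Y => periodicInteraction v L Y * ((‖Ψ.ψ Y‖₊ : ℝ≥0∞)) ^ 2 with hG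
  have hGper : ∀ (Y : Config N) (i : Fin N) (k : Fin 3), G (Y + Pi.single i (EuclideanSpace.single k L)) = G Y :=
    fun Y i k => by simp only [hG, periodicInteraction_add_single, Ψ.periodic]
  -- the open set where the shifted configuration is inside the core image and `Ψ ≠ 0`, inside the open box
  set U : Set (Config N) := {Y | (∀ i k, Y i k ∈ Set.Ioo 0 L) ∧
      ‖(Y + T) i - (Y + T) j - latticeVec L m‖ < a ∧ Ψ.ψ (Y + T) ≠ 0} with hU
  have hUo : IsOpen U := by
    refine (isOpen_openBox N L).inter (IsOpen.inter ?_ ?_)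
    · exact isOpen_lt ((((continuous_apply i).add continuous_const).sub
        ((continuous_apply j).add continuous_const)).sub continuous_const).norm continuous_const
    · exact isOpen_ne_fun (Ψ.contDiff.continuous.comp (continuous_id.add continuous_const)) continuous_const
  have hcU : c ∈ U := by
    refine ⟨fun i k => ⟨by simp [hc]; linarith, by simp [hc]; linarith⟩, ?_, ?_⟩
    · simpa only [hT, add_sub_cancel] using hm
    · simpa only [hT, add_sub_cancel] using hX
  have hUpos : volume U ≠ 0 := (hUo.measure_pos volume ⟨c, hcU⟩).ne'
  have hUcell : U ⊆ cellN N L := fun Y hY i k => Set.Ioo_subset_Ico_self (hY.1 i k)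
  have hGtop : ∀ Y ∈ U, G (Y + T) = ⊤ := by
    intro Y hY
    simp only [hG]
    rw [periodicInteraction_eq_top hcore L hij hY.2.1.le, ENNReal.top_mul]
    exact pow_ne_zero _ (by simpa using hY.2.2)
  -- the potential energy is infinite
  have key : ∫⁻ Y in cellN N L, G Y = ⊤ := by
    rw [← lintegral_cellN_comp_add hL hGper T]
    refine eq_top_iff.2 ?_
    calc (⊤ : ℝ≥0∞) = ∫⁻ _ in U, (⊤ : ℝ≥0∞) := by rw [setLIntegral_const, ENNReal.top_mul hUpos]
      _ = ∫⁻ Y in U, G (Y + T) := setLIntegral_congr_fun hUo.measurableSet fun Y hY => (hGtop Y hY).symm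
      _ ≤ ∫⁻ Y in cellN N L, G (Y + T) := lintegral_mono_set hUcell
  refine hE (eq_top_iff.2 ?_)
  calc (⊤ : ℝ≥0∞) = ∫⁻ Y in cellN N L, G Y := key.symm
    _ ≤ periodicEnergy v Ψ := lintegral_mono fun Y => le_add_self

/-- **Hard-core support.** Wherever a periodic trial state of finite energy does not vanish, all lattice images
of all pairs are at least the core radius apart: `Ψ X ≠ 0 ⇒ a ≤ |xᵢ - xⱼ - Lm|` for `i ≠ j`, `m ∈ ℤ³`. [folklore] -/
theorem le_norm_sub_sub_latticeVec {v : ℝ → ℝ≥0∞} {a : ℝ} (hcore : ∀ r, 0 ≤ r → r ≤ a → v r = ⊤) (hL : 0 < L)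
    (Ψ : PeriodicTrialState N L) (hE : periodicEnergy v Ψ ≠ ⊤) {X : Config N} (hX : Ψ.ψ X ≠ 0) {i j : Fin N}
    (hij : i ≠ j) (m : Fin 3 → ℤ) : a ≤ ‖X i - X j - latticeVec L m‖ := by
  by_contra h
  rw [not_le] at h
  rcases lt_or_gt_of_ne hij with hlt | hlt
  · exact hX (psi_eq_zero_of_lt hcore hL Ψ hE hlt h)
  · refine hX (psi_eq_zero_of_lt hcore hL Ψ hE hlt (m := -m) ?_)
    rwa [latticeVec_neg, sub_neg_eq_add, ← norm_neg, neg_add', neg_sub]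

/-! #### Packing of the active bath particles -/



/-- Differences of reduced vectors are lattice images of the difference. [folklore] -/
theorem reduce_sub_reduce (L : ℝ) (x u w : Space) :
    reduce L (x - u) - reduce L (x - w) = w - u - latticeVec L (nearestLat L (x - u) - nearestLat L (x - w)) := by
  simp only [reduce, latticeVec_sub]
  abel

/-- **Packing of the active bath particles.** If all lattice images of all pairs of the configuration `Y` are
`≥ a` apart (`a > 0`), then for every `x ∈ ℝ³` the bath particles `yⱼ₊₁` whose nearest image `reduce L (x - yⱼ₊₁)`
lies in the closed ball of radius `b ≥ 0` form a set of at most `(1 + 2b/a)³` indices (the reduced vectors are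
pairwise `≥ a` apart: volume packing, hypothesis `hPk` = the landed `stub_hardCorePacking`). [folklore] -/
theorem exists_active_finset
    (hPk : ∀ (a R : ℝ), 0 < a → 0 ≤ R → ∀ (s : Finset Space) (p : Space),
      (∀ x ∈ s, ∀ y ∈ s, x ≠ y → a ≤ ‖x - y‖) → (∀ x ∈ s, ‖x - p‖ ≤ R) → (s.card : ℝ) ≤ (1 + 2 * R / a) ^ 3)
    {a b : ℝ} (ha : 0 < a) (hb : 0 ≤ b) (L : ℝ) {n : ℕ} {Y : Config (n + 1)}
    (hsep : ∀ i j : Fin (n + 1), i ≠ j → ∀ m : Fin 3 → ℤ, a ≤ ‖Y i - Y j - latticeVec L m‖) (x : Space) :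
    ∃ S : Finset (Fin n), (S.card : ℝ) ≤ (1 + 2 * b / a) ^ 3 ∧ ∀ j, j ∉ S → b < ‖reduce L (x - Y j.succ)‖ := by
  classical
  set z : Fin n → Space := fun j => reduce L (x - Y j.succ) with hz
  set S : Finset (Fin n) := Finset.univ.filter fun j => ‖z j‖ ≤ b with hS
  have hzsep : ∀ j j' : Fin n, j ≠ j' → a ≤ ‖z j - z j'‖ := fun j j' hjj' => by
    rw [hz, reduce_sub_reduce]
    exact hsep _ _ (fun h => hjj' (Fin.succ_injective _ h).symm) _
  have hinj : Set.InjOn z ↑S := fun j _ j' _ hjj' => by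
    by_contra hne
    have h := hzsep j j' hne
    rw [hjj', sub_self, norm_zero] at h
    exact absurd h (not_le.2 ha)
  refine ⟨S, ?_, fun j hj => not_le.1 fun h => hj (Finset.mem_filter.2 ⟨Finset.mem_univ _, h⟩)⟩
  rw [← Finset.card_image_of_injOn hinj]
  refine hPk a b ha hb (S.image z) 0 ?_ ?_
  · intro p hp p' hp' hpp'
    obtain ⟨j, -, rfl⟩ := Finset.mem_image.1 hp
    obtain ⟨j', -, rfl⟩ := Finset.mem_image.1 hp'
    exact hzsep j j' fun h => hpp' (by rw [h])
  · intro p hp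
    obtain ⟨j, hj, rfl⟩ := Finset.mem_image.1 hp
    rw [sub_zero]
    exact (Finset.mem_filter.1 hj).2


variable {b : ℝ} {φ : Space → ℝ}

/-! #### The one-body kernel `G = c₁ |∇Φ|² + (1 - Φ²)` of a periodic pair factor `Φ = pairFactor L φ` -/

/-- The kernel `G(y) = c₁ |∇Φ|²(y) + (1 - Φ(y)²)` is measurable. [folklore] -/
theorem measurable_kernel (hφ : IsPairProfile b φ) (hL : 0 < L) (hbL : 2 * b < L) (c₁ : ℝ≥0∞) :
    Measurable fun y : Space => c₁ * gradSq (pairFactor L φ) y + ENNReal.ofReal (1 - pairFactor L φ y ^ 2) :=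
  ((hφ.measurable_gradSq_pairFactor hL hbL).const_mul _).add
    (continuous_const.sub ((hφ.contDiff_pairFactor hL hbL).continuous.pow 2)).measurable.ennreal_ofReal

/-- The kernel is even. [folklore] -/
theorem kernel_neg (hφ : IsPairProfile b φ) (hL : 0 < L) (hbL : 2 * b < L) (c₁ : ℝ≥0∞) (y : Space) :
    c₁ * gradSq (pairFactor L φ) (-y) + ENNReal.ofReal (1 - pairFactor L φ (-y) ^ 2) =
      c₁ * gradSq (pairFactor L φ) y + ENNReal.ofReal (1 - pairFactor L φ y ^ 2) := by
  rw [hφ.gradSq_pairFactor_neg hL hbL, hφ.pairFactor_neg hL hbL.le]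

/-- The kernel is `Lℤ³`-periodic. [folklore] -/
theorem kernel_add_latticeVec (hφ : IsPairProfile b φ) (hL : 0 < L) (hbL : 2 * b < L) (c₁ : ℝ≥0∞) (y : Space)
    (m : Fin 3 → ℤ) :
    c₁ * gradSq (pairFactor L φ) (y + latticeVec L m) + ENNReal.ofReal (1 - pairFactor L φ (y + latticeVec L m) ^ 2) =
      c₁ * gradSq (pairFactor L φ) y + ENNReal.ofReal (1 - pairFactor L φ y ^ 2) := by
  rw [hφ.gradSq_pairFactor hL hbL, hφ.gradSq_pairFactor hL hbL, reduce_add_latticeVec hL.ne',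
    pairFactor_add_latticeVec hL.ne']

/-- **Cell average of the kernel**: `∫_{[0,L)³} G(t - z) dt ≤ c₁ ∫_{ℝ³} |∇φ|² + ∫_{ℝ³} (1 - φ²)` for every `z`
(unfolding the torus, `IsPairProfile.lintegral_cell_gradSq_le` / `…defect_le`). [folklore] -/
theorem lintegral_cell_kernel_le (hφ : IsPairProfile b φ) (hL : 0 < L) (hbL : 2 * b < L) (c₁ : ℝ≥0∞) (z : Space) :
    ∫⁻ t in cell L, (c₁ * gradSq (pairFactor L φ) (t - z) + ENNReal.ofReal (1 - pairFactor L φ (t - z) ^ 2)) ≤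
      c₁ * (∫⁻ x, gradSq φ x) + profileDefect φ := by
  have hm : Measurable fun t : Space => gradSq (pairFactor L φ) (t - z) :=
    (hφ.measurable_gradSq_pairFactor hL hbL).comp (measurable_id.sub_const z)
  have hm' : Measurable fun t : Space => c₁ * gradSq (pairFactor L φ) (t - z) := hm.const_mul _
  rw [lintegral_add_left hm', lintegral_const_mul _ hm]
  exact add_le_add (mul_le_mul_right (hφ.lintegral_cell_gradSq_le hL hbL z) _) (hφ.lintegral_cell_defect_le hL z)

/-! #### The two-copy cross weight `W(X, Y) = ∑ⱼ (G(x₀ - yⱼ₊₁) + G(y₀ - xⱼ₊₁))` -/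

variable {n : ℕ}

/-- The cross weight is measurable (for a measurable kernel). [folklore] -/
theorem measurable_crossKernel {G : Space → ℝ≥0∞} (hG : Measurable G) :
    Measurable fun Z : Config (n + 1) × Config (n + 1) =>
      ∑ j : Fin n, (G (Z.1 0 - Z.2 j.succ) + G (Z.2 0 - Z.1 j.succ)) := by
  refine Finset.measurable_sum _ fun j _ => Measurable.add ?_ ?_
  · exact hG.comp (((measurable_pi_apply 0).comp measurable_fst).sub ((measurable_pi_apply j.succ).comp measurable_snd))
  · exact hG.comp (((measurable_pi_apply 0).comp measurable_snd).sub ((measurable_pi_apply j.succ).comp measurable_fst))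

/-- The cross weight is `Lℤ³`-periodic in every particle of the second copy (for a periodic kernel). [folklore] -/
theorem crossKernel_add_single {G : Space → ℝ≥0∞} (hG : ∀ (y : Space) (m : Fin 3 → ℤ), G (y + latticeVec L m) = G y)
    (X Y : Config (n + 1)) (i : Fin (n + 1)) (k : Fin 3) :
    (∑ j : Fin n, (G (X 0 - (Y + Pi.single i (EuclideanSpace.single k L) : Config (n + 1)) j.succ) +
        G ((Y + Pi.single i (EuclideanSpace.single k L) : Config (n + 1)) 0 - X j.succ))) =
      ∑ j : Fin n, (G (X 0 - Y j.succ) + G (Y 0 - X j.succ)) := by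
  have hsub : ∀ (y : Space) (m : Fin 3 → ℤ), G (y - latticeVec L m) = G y := fun y m => by
    rw [sub_eq_add_neg, ← latticeVec_neg, hG]
  refine Finset.sum_congr rfl fun j _ => ?_
  obtain ⟨m, hm⟩ := exists_apply_add_single Y i k L 0
  obtain ⟨m', hm'⟩ := exists_apply_add_single Y i k L j.succ
  rw [hm, hm', ← sub_sub, hsub, add_sub_right_comm, hG]

/-- **Cell average of the shifted cross weight**: if the kernel is even with cell averages `≤ C`, then
`∫_{[0,L)³} W(X, Y + t𝟙) dt ≤ n · (2C)`. [folklore] -/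
theorem lintegral_cell_crossKernel_shift_le {G : Space → ℝ≥0∞} (hGm : Measurable G) (hGe : ∀ y, G (-y) = G y)
    {C : ℝ≥0∞} (hGC : ∀ z, ∫⁻ t in cell L, G (t - z) ≤ C) (Z : Config (n + 1) × Config (n + 1)) :
    ∫⁻ t in cell L, ∑ j : Fin n, (G (Z.1 0 - (Z.2 + fun _ => t : Config (n + 1)) j.succ) +
        G ((Z.2 + fun _ => t : Config (n + 1)) 0 - Z.1 j.succ)) ≤ (n : ℝ≥0∞) * (2 * C) := by
  simp only [Pi.add_apply]
  have h1 : ∀ j : Fin n, Measurable fun t : Space => G (Z.1 0 - (Z.2 j.succ + t)) :=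
    fun j => hGm.comp ((measurable_const_add _).const_sub _)
  have h2 : ∀ j : Fin n, Measurable fun t : Space => G (Z.2 0 + t - Z.1 j.succ) :=
    fun j => hGm.comp ((measurable_const_add _).sub_const _)
  have h12 : ∀ j : Fin n, Measurable fun t : Space => G (Z.1 0 - (Z.2 j.succ + t)) + G (Z.2 0 + t - Z.1 j.succ) :=
    fun j => (h1 j).add (h2 j)
  rw [lintegral_finsetSum _ fun j _ => h12 j]
  calc ∑ j : Fin n, ∫⁻ t in cell L, (G (Z.1 0 - (Z.2 j.succ + t)) + G (Z.2 0 + t - Z.1 j.succ))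
      ≤ ∑ _j : Fin n, (C + C) := by
        refine Finset.sum_le_sum fun j _ => ?_
        rw [lintegral_add_left (h1 j)]
        refine add_le_add ?_ ?_
        · refine le_of_eq_of_le (lintegral_congr fun t => ?_) (hGC (Z.1 0 - Z.2 j.succ))
          rw [← hGe (t - (Z.1 0 - Z.2 j.succ)), show -(t - (Z.1 0 - Z.2 j.succ)) = Z.1 0 - (Z.2 j.succ + t) by abel]
        · refine le_of_eq_of_le (lintegral_congr fun t => ?_) (hGC (Z.1 j.succ - Z.2 0))
          rw [show t - (Z.1 j.succ - Z.2 0) = Z.2 0 + t - Z.1 j.succ by abel]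
    _ = (n : ℝ≥0∞) * (2 * C) := by
        rw [Finset.sum_const, Finset.card_univ, Fintype.card_fin, nsmul_eq_mul, two_mul]

/-! #### Translation averaging (the `≤` form of `UpperFrameIntegrable.lintegral_cell_translate_eq`) -/

/-- **Averaging over translations of the second copy, inequality form**: if `W` is measurable, periodic in the
second copy, and the translation averages of its shifts are `≤ C`, then
`∫_{[0,L)³} ∫_{cell²} W(X, Y) |Ψ X · Ψ(Y - t𝟙)|² dt ≤ C`. [folklore] -/
theorem lintegral_cell_translate_le (hL : 0 < L) (Ψ : PeriodicTrialState N L)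
    {W : Config N × Config N → ℝ≥0∞} (hW : Measurable W)
    (hWper : ∀ (X Y : Config N) (i : Fin N) (k : Fin 3),
      W (X, Y + Pi.single i (EuclideanSpace.single k L)) = W (X, Y))
    {C : ℝ≥0∞} (hC : ∀ Z : Config N × Config N, ∫⁻ t in cell L, W (Z.1, Z.2 + fun _ => t) ≤ C) :
    ∫⁻ t in cell L, ∫⁻ Z in cellN N L ×ˢ cellN N L,
        W Z * ((‖Ψ.ψ Z.1 * Ψ.ψ (Z.2 - fun _ => t)‖₊ : ℝ≥0∞)) ^ 2 ≤ C := by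
  -- adapted from `UpperFrameIntegrable.lintegral_cell_translate_eq` (equality version)
  haveI : SFinite (volume : Measure (Config N)) := instSFiniteOfSigmaFinite
  haveI : SFinite (volume : Measure Space) := instSFiniteOfSigmaFinite
  have hn : Measurable fun X : Config N => ((‖Ψ.ψ X‖₊ : ℝ≥0∞)) ^ 2 :=
    measurable_normSq Ψ.contDiff.continuous
  have hρ : Measurable fun Z : Config N × Config N =>
      ((‖Ψ.ψ Z.1‖₊ : ℝ≥0∞)) ^ 2 * ((‖Ψ.ψ Z.2‖₊ : ℝ≥0∞)) ^ 2 :=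
    (hn.comp measurable_fst).mul (hn.comp measurable_snd)
  have hsh : Measurable fun p : Space × (Config N × Config N) => W (p.2.1, p.2.2 + fun _ => p.1) :=
    hW.comp (continuous_snd.fst.prodMk
      (continuous_snd.snd.add (continuous_pi fun _ => continuous_fst))).measurable
  have hF : AEMeasurable (Function.uncurry fun (t : Space) (Z : Config N × Config N) =>
      W (Z.1, Z.2 + fun _ => t) * (((‖Ψ.ψ Z.1‖₊ : ℝ≥0∞)) ^ 2 * ((‖Ψ.ψ Z.2‖₊ : ℝ≥0∞)) ^ 2))
      (((volume : Measure Space).restrict (cell L)).prod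
        ((volume : Measure (Config N × Config N)).restrict (cellN N L ×ˢ cellN N L))) :=
    (hsh.mul (hρ.comp measurable_snd)).aemeasurable
  calc ∫⁻ t in cell L, ∫⁻ Z in cellN N L ×ˢ cellN N L,
          W Z * ((‖Ψ.ψ Z.1 * Ψ.ψ (Z.2 - fun _ => t)‖₊ : ℝ≥0∞)) ^ 2
      = ∫⁻ t in cell L, ∫⁻ Z in cellN N L ×ˢ cellN N L,
          W (Z.1, Z.2 + fun _ => t) * (((‖Ψ.ψ Z.1‖₊ : ℝ≥0∞)) ^ 2 * ((‖Ψ.ψ Z.2‖₊ : ℝ≥0∞)) ^ 2) := by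
        refine lintegral_congr fun t => ?_
        simp_rw [ennnorm_mul_sq]
        exact UpperFrameIntegrable.lintegral_shift_snd hL Ψ hW hWper fun _ => t
    _ = ∫⁻ Z in cellN N L ×ˢ cellN N L, ∫⁻ t in cell L,
          W (Z.1, Z.2 + fun _ => t) * (((‖Ψ.ψ Z.1‖₊ : ℝ≥0∞)) ^ 2 * ((‖Ψ.ψ Z.2‖₊ : ℝ≥0∞)) ^ 2) :=
        lintegral_lintegral_swap hF
    _ ≤ ∫⁻ Z in cellN N L ×ˢ cellN N L,
          C * (((‖Ψ.ψ Z.1‖₊ : ℝ≥0∞)) ^ 2 * ((‖Ψ.ψ Z.2‖₊ : ℝ≥0∞)) ^ 2) := by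
        refine lintegral_mono fun Z => ?_
        have hm : Measurable fun t : Space => W (Z.1, Z.2 + fun _ => t) :=
          hsh.comp (measurable_id.prodMk measurable_const)
        rw [lintegral_mul_const _ hm]
        exact mul_le_mul_left (hC Z) _
    _ = C := by rw [lintegral_const_mul C hρ, UpperFrameIntegrable.lintegral_normSq_mul_normSq Ψ Ψ, mul_one]

/-- The translated cross integral `t ↦ ∫_{cell²} W |Ψ X · Ψ(Y - t𝟙)|²` is a measurable function of the
translation (joint measurability and Tonelli). [folklore] -/
theorem measurable_lintegral_translate (Ψ : PeriodicTrialState N L) {W : Config N × Config N → ℝ≥0∞}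
    (hW : Measurable W) :
    Measurable fun t : Space => ∫⁻ Z in cellN N L ×ˢ cellN N L,
      W Z * ((‖Ψ.ψ Z.1 * Ψ.ψ (Z.2 - fun _ => t)‖₊ : ℝ≥0∞)) ^ 2 := by
  haveI : SFinite (volume : Measure (Config N)) := instSFiniteOfSigmaFinite
  have hc : Continuous fun p : Space × (Config N × Config N) => Ψ.ψ p.2.1 * Ψ.ψ (p.2.2 - fun _ => p.1) :=
    (Ψ.contDiff.continuous.comp continuous_snd.fst).mul
      (Ψ.contDiff.continuous.comp (continuous_snd.snd.sub (continuous_pi fun _ => continuous_fst)))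
  exact ((hW.comp measurable_snd).mul (hc.measurable.nnnorm.coe_nnreal_ennreal.pow_const 2)).lintegral_prod_right'

end UpperFrameHardCoreSupport

/-! ### The registered helper stub of part B -/

/-- Part B of `stub_upperFrameHardCore` (helper stub `stub_upperFrameHardCoreSupport`, registered signature):
**hard-core support** — wherever a periodic trial state of finite energy for a profile with `v = ⊤` on `[0, a]` does
not vanish, all lattice images of all pairs are at least `a` apart. [folklore] -/
theorem stub_upperFrameHardCoreSupport :
    ∀ (v : ℝ → ℝ≥0∞) (a L : ℝ) (N : ℕ), (∀ r : ℝ, 0 ≤ r → r ≤ a → v r = ⊤) → 0 < L → ∀ Ψ : PeriodicTrialState N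
      L, periodicEnergy v Ψ ≠ ⊤ → ∀ X : Config N, Ψ.ψ X ≠ 0 → ∀ i j : Fin N, i ≠ j → ∀ m : Fin 3 → ℤ, a ≤ ‖X i -
      X j - latticeVec L m‖ :=
  fun _ _ _ _ hcore hL Ψ hE _ hX _ _ hij m => UpperFrameHardCoreSupport.le_norm_sub_sub_latticeVec hcore hL Ψ hE hX hij m

end Summit.AtomisticToContinuum.BoseEinsteinCondensation.Cruxes.TorusHalfSwapOverlap.Birth

end
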